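import Literature.NumberTheory.PAdicHodge.CoboundaryOfPeriodHoms
import HarnessLib

/-!
# `Fil⁰`-coboundaries from integrated periods: the Legendre-transversal pair (`IsFilZeroCoboundary`)

Topic `Literature/NumberTheory/PAdicHodge`; §1 in namespace `Literature.NumberTheory.GaloisRepresentations.PeriodRingData`
(sequel of `CoboundaryOfPeriodHoms`: periods detect coboundaries in `B ⊗ V`), §2 in `Literature.NumberTheory.PAdicHodge`.
THEOREMS ONLY (no definition, no named fact, no instance, no `sorry`).

`CoboundaryOfPeriodHoms` produces, from `n` equivariant functionals `Φ` and integrated periods `φᵢ(c σ) = σ bᵢ − bᵢ`, the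
element `x = ∑ₖ (H⁻¹ b)ₖ (1 ⊗ vₖ)` of `B ⊗_P V` with `1 ⊗ c(σ) = σ(x) − x`. Kato's `exp*` / Bloch–Kato need `x` in
`Fil⁰B ⊗ V` (`IsFilZeroCoboundary`, file `BlochKatoDualExponential`; for `B_dR`: `x ∈ B_dR⁺ ⊗ V`). In general that is
Bloch–Kato Lemma 3.8.1; for the ELLIPTIC SHAPE it is elementary filtration bookkeeping («Legendre transversality»):

* §1 **`isFilZeroCoboundary_of_pair_of_legendre`** (`dim V = 2`, basis `v`): if `φ₁(V) ⊆ Fil¹`, `φ₂(V) ⊆ Fil⁰`, `φ₁ ≠ 0`,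
  `φ₂(m) ∉ Fil¹` for some `m`; `b₁ ∈ Fil¹`, `b₂ ∈ Fil⁰` integrate the periods of `c`; and the period DETERMINANT
  `Δ = φ₁(v₀)φ₂(v₁) − φ₁(v₁)φ₂(v₀)` DIVIDES `Fil¹` INTO `Fil⁰` (`∀ y ∈ Fil¹, ∃ z ∈ Fil⁰, y = z·Δ` — for `B_dR`: `Δ ∈ Fil¹ ∖ Fil²`,
  Legendre's relation `Δ ∈ t·(B_dR⁺)ˣ`), then `σ ↦ 1 ⊗ c(σ)` is a `Fil⁰`-coboundary: `𝔅.IsFilZeroCoboundary ρ (1 ⊗ c)`.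
  Proof: `H⁻¹b = adj(H)b/Δ` and both entries of `adj(H)b` lie in `Fil¹·Fil⁰ + Fil⁰·Fil¹ ⊆ Fil¹`
  (`adjugate_mulVec_mem_fil_one`), so `H⁻¹b ∈ (Fil⁰)²`. The explicit element and its coboundary property in a GIVEN basis
  are `tensorRep_sub_eq_of_equivariant_basis` (basis form of `exists_tensorRep_sub_eq_of_equivariant`).
* §2 **`isFilZeroCoboundary_restrictedRationalTateRep_of_periodHoms_of_legendre`**: the Tate-module dialect of (S5a)
  `expStarCoord_eq_zero_iff_kummer` — `W/K₀`, `K₀ ⊆ F`, `φ₁ φ₂ : T_pW →+ B_dR(F)` (intended `∫ω ∈ Fil¹`, `∫η ∈ B_dR⁺`), a map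
  `η : Γ_F → T_pW` with `φ₁(η σ) = σ b₁ − b₁` (`b₁ ∈ Fil¹`), `φ₂(η σ) = σ b₂ − b₂` (`b₂ ∈ Fil⁰`), and the Legendre divisibility
  for `Δ = φ₁(τ₀)φ₂(τ₁) − φ₁(τ₁)φ₂(τ₀)` on a `ℚ_p`-basis `(τ₀, τ₁)` of `V_pW` coming from `T_pW`
  ⟹ `(bdRPeriodRingData hp).IsFilZeroCoboundary (restrictedRationalTateRep W F p) (σ ↦ 1 ⊗ toRational (η σ))` VERBATIM the
  conclusion of (S5a).

Use (brick K1 of the hT₂ programme of crux K★ `stmt-BirchSwinnertonDyer-22226`): the integrating pair of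
`AinfWeierstrassKummerIntegral{,Eta}` has `b_ω ∈ Fil¹` (`bOmega_mem_filOne`) and `b_η ∈ B_dR⁺`, `∫ω ∈ Fil¹`, `∫η ∈ B_dR⁺`; the
remaining input is the Legendre/Hodge–Tate transversality `Δ ∉ Fil²` (Colmez 1992 §2: `Δ = t × (Weil pairing)`; equivalently
Tate's `ℂ_F(1)^{Γ_F} = 0` applied to the ratio of the Hodge–Tate map and `θ ∘ ∫η`). BSD / K★ are not proved by any of this.

## References
* [BlochKato1990] S. Bloch, K. Kato, *L-functions and Tamagawa numbers of motives* (1990), Ex. 3.10.1, (3.11.1), Lemma 3.8.1.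
* [Kato1993LNM1553] K. Kato, LNM 1553 (1993), Ch. II §1.2.4, Lemma 1.4.3.
* [Colmez1992PeriodesAbeliennes] P. Colmez, Math. Ann. 292 (1992), §2 (Legendre's relation for `p`-adic periods).
* [FontaineAsterisque223III] J.-M. Fontaine, Astérisque 223 (1994), Exp. III Thm. 1.5.2.
-/

noncomputable section

open Matrix
open scoped TensorProduct

/-! ## §1 The explicit integrating element in a basis and its `Fil⁰`-membership -/

namespace Literature.NumberTheory.GaloisRepresentations.PeriodRingData

section PeriodHoms

-- Mathlib's own global value of `maxSynthPendingDepth` (see `PeriodRingData.finrank_D_le_holds`).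
set_option maxSynthPendingDepth 3

universe u v v' w w'

variable {Γ : Type u} [Group Γ] [TopologicalSpace Γ] {P : Type v} {E : Type v'} [Field P]
  [TopologicalSpace P] [Field E] [Algebra P E]
  {M : Type w'} [AddCommGroup M] [Module P M] [TopologicalSpace M]
  (𝔅 : PeriodRingData.{u, v, v', w} Γ P E) (ρ : ContinuousRep Γ P M)

/-- **The period matrix `H = (φᵢ(vⱼ))` of independent equivariant functionals has unit determinant and satisfies
`R(σ)·σ(H⁻¹) = H⁻¹`** (in any basis `v`; extracted from `isAdmissible_of_equivariant`).
[cite: FontaineAsterisque223III, Exp. III Prop. 1.5.2 and Thm. 1.5.2] -/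
theorem isUnit_det_and_periodMatrix_of_equivariant {ι : Type*} [Fintype ι] [DecidableEq ι] (v : Module.Basis ι P M)
    {Φ : ι → (M →ₗ[P] 𝔅.B)} (hΦ : ∀ i σ m, Φ i (ρ σ m) = σ • Φ i m) (hli : LinearIndependent E Φ) :
    IsUnit (Matrix.of fun i j => Φ i (v j)).det ∧
      ∀ σ, (LinearMap.toMatrix v v (ρ σ)).map (algebraMap P 𝔅.B) *
          (MulSemiringAction.toRingHom Γ 𝔅.B σ).mapMatrix (Matrix.of fun i j => Φ i (v j))⁻¹ =
        (Matrix.of fun i j => Φ i (v j))⁻¹ := by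
  classical
  haveI : FiniteDimensional P M := Module.Finite.of_basis v
  set H : Matrix ι ι 𝔅.B := Matrix.of fun i j => Φ i (v j) with hH
  let R : Γ → Matrix ι ι P := fun σ => LinearMap.toMatrix v v (ρ σ)
  let g : Γ → 𝔅.B →+* 𝔅.B := fun σ => MulSemiringAction.toRingHom Γ 𝔅.B σ
  have hliB : LinearIndependent 𝔅.B Φ := 𝔅.linearIndependent_of_equivariant ρ hΦ hli
  have hdet : H.det ≠ 0 := by
    intro h0
    obtain ⟨c', hc0, hc'⟩ := Matrix.exists_vecMul_eq_zero_iff.2 h0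
    have hrel : ∑ i, c' i • Φ i = 0 := by
      refine v.ext fun j => ?_
      have hj : ∑ i, c' i * H i j = 0 := by
        have h := congrFun hc' j
        simpa only [Matrix.vecMul, dotProduct, Pi.zero_apply] using h
      simpa only [LinearMap.coe_sum, Finset.sum_apply, LinearMap.smul_apply, smul_eq_mul, LinearMap.zero_apply,
        hH, Matrix.of_apply] using hj
    exact hc0 (funext fun i => Fintype.linearIndependent_iff.1 hliB c' hrel i)
  have hσH : ∀ σ, (g σ).mapMatrix H = H * (R σ).map (algebraMap P 𝔅.B) := fun σ => by
    ext i j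
    rw [RingHom.mapMatrix_apply, Matrix.map_apply, Matrix.mul_apply]
    simp only [hH, Matrix.of_apply, Matrix.map_apply, g, MulSemiringAction.toRingHom_apply]
    exact 𝔅.smul_apply_basis_of_equivariant ρ v (hΦ i) σ j
  have hunit : IsUnit H.det := by
    refine 𝔅.isUnit_of_smul_mem H.det hdet fun σ => ⟨(R σ).det, ?_⟩
    have h1 : σ • H.det = (g σ) H.det := rfl
    rw [h1, RingHom.map_det, hσH σ, Matrix.det_mul, ← RingHom.mapMatrix_apply, ← RingHom.map_det,
      𝔅.algebraMap_eq, mul_comm]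
  refine ⟨hunit, fun σ => ?_⟩
  calc (R σ).map (algebraMap P 𝔅.B) * (g σ).mapMatrix H⁻¹
      = H⁻¹ * H * ((R σ).map (algebraMap P 𝔅.B) * (g σ).mapMatrix H⁻¹) := by
        rw [Matrix.nonsing_inv_mul H hunit, Matrix.one_mul]
    _ = H⁻¹ * (g σ).mapMatrix (H * H⁻¹) := by
        rw [map_mul, hσH σ, Matrix.mul_assoc, Matrix.mul_assoc]
    _ = H⁻¹ := by rw [Matrix.mul_nonsing_inv H hunit, map_one, Matrix.mul_one]

/-- **The explicit integrating element in a basis**: with `H = (φᵢ(vⱼ))` and `x = ∑ₖ (H⁻¹ b)ₖ (1 ⊗ vₖ)`,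
`1 ⊗ c(σ) = σ(x) − x` for every `σ` (basis form of `exists_tensorRep_sub_eq_of_equivariant`).
[cite: FontaineAsterisque223III, Exp. III Thm. 1.5.2] [cite: BlochKato1990, Ex. 3.10.1] -/
theorem tensorRep_sub_eq_of_equivariant_basis {ι : Type*} [Fintype ι] [DecidableEq ι] (v : Module.Basis ι P M)
    {Φ : ι → (M →ₗ[P] 𝔅.B)} (hΦ : ∀ i σ m, Φ i (ρ σ m) = σ • Φ i m) (hli : LinearIndependent E Φ)
    (c : Γ → M) (b : ι → 𝔅.B) (hc : ∀ i σ, Φ i (c σ) = σ • b i - b i) (σ : Γ) :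
    ((1 : 𝔅.B) ⊗ₜ[P] c σ : 𝔅.B ⊗[P] M) =
      𝔅.tensorRep ρ σ (∑ i, ((Matrix.of fun i j => Φ i (v j))⁻¹ *ᵥ b) i • Algebra.TensorProduct.basis 𝔅.B v i) -
        ∑ i, ((Matrix.of fun i j => Φ i (v j))⁻¹ *ᵥ b) i • Algebra.TensorProduct.basis 𝔅.B v i := by
  classical
  set H : Matrix ι ι 𝔅.B := Matrix.of fun i j => Φ i (v j) with hH
  let R : Γ → Matrix ι ι P := fun σ => LinearMap.toMatrix v v (ρ σ)
  let g : Γ → 𝔅.B →+* 𝔅.B := fun σ => MulSemiringAction.toRingHom Γ 𝔅.B σ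
  obtain ⟨hunit, hRC⟩ := 𝔅.isUnit_det_and_periodMatrix_of_equivariant ρ v hΦ hli
  let γ : ι → 𝔅.B := fun k => algebraMap P 𝔅.B (v.repr (c σ) k)
  have hHγ : H *ᵥ γ = fun i => σ • b i - b i := by
    funext i
    rw [← hc i σ, 𝔅.apply_eq_sum_basis v (Φ i) (c σ), Matrix.mulVec, dotProduct]
    refine Finset.sum_congr rfl fun k _ => ?_
    simp only [hH, Matrix.of_apply, γ, mul_comm]
  have hσx : (fun i => σ • (H⁻¹ *ᵥ b) i) = (g σ).mapMatrix H⁻¹ *ᵥ fun i => σ • b i := by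
    funext i
    have h := RingHom.map_mulVec (g σ) H⁻¹ b i
    simp only [g, MulSemiringAction.toRingHom_apply] at h
    rw [h]
    rfl
  have hcoord : (R σ).map (algebraMap P 𝔅.B) *ᵥ (fun i => σ • (H⁻¹ *ᵥ b) i) - H⁻¹ *ᵥ b = γ := by
    rw [hσx, Matrix.mulVec_mulVec, hRC σ, ← Matrix.mulVec_sub]
    have hb : (fun i => σ • b i) - b = H *ᵥ γ := by
      rw [hHγ]
      rfl
    rw [hb, Matrix.mulVec_mulVec, Matrix.nonsing_inv_mul H hunit, Matrix.one_mulVec]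
  rw [𝔅.tensorRep_sum_smul_basis_vec ρ v σ, 𝔅.one_tmul_eq_sum_basis v (c σ), ← Finset.sum_sub_distrib]
  refine Finset.sum_congr rfl fun k _ => ?_
  rw [← sub_smul]
  exact congrArg (· • Algebra.TensorProduct.basis 𝔅.B v k) (congrFun hcoord k).symm

omit [TopologicalSpace Γ] [TopologicalSpace P] [TopologicalSpace M] in
/-- A `B`-combination `∑ₖ zₖ (1 ⊗ vₖ)` with all `zₖ ∈ Fil^i` lies in `Fil^i B ⊗ V`. [cite: Kato1993LNM1553, Ch. II §1.2.4] -/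
theorem sum_smul_basis_mem_filTensor {ι : Type*} [Fintype ι] (v : Module.Basis ι P M) {i : ℤ}
    {z : ι → 𝔅.B} (hz : ∀ k, z k ∈ 𝔅.fil i) :
    ∑ k, z k • Algebra.TensorProduct.basis 𝔅.B v k ∈ 𝔅.filTensor M i := by
  refine Submodule.sum_mem _ fun k _ => ?_
  rw [Algebra.TensorProduct.basis_apply, TensorProduct.smul_tmul', smul_eq_mul, mul_one]
  exact ⟨(⟨z k, hz k⟩ : 𝔅.fil i) ⊗ₜ[P] v k, rfl⟩

omit [TopologicalSpace Γ] [TopologicalSpace P] [TopologicalSpace M] in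
/-- **The adjugate bookkeeping**: for `H = (φᵢ(vⱼ))` with `φ₁(V) ⊆ Fil¹`, `φ₂(V) ⊆ Fil⁰` and `b₁ ∈ Fil¹`, `b₂ ∈ Fil⁰`, both
entries of `adj(H)·b` lie in `Fil¹` (`Fil^a · Fil^b ⊆ Fil^{a+b}`). [cite: BlochKato1990, Lemma 3.8.1] -/
theorem adjugate_mulVec_mem_fil_one (v : Module.Basis (Fin 2) P M) {φ₁ φ₂ : M →ₗ[P] 𝔅.B}
    (hfil₁ : ∀ m, φ₁ m ∈ 𝔅.fil 1) (hfil₂ : ∀ m, φ₂ m ∈ 𝔅.fil 0) {b₁ b₂ : 𝔅.B} (hb₁ : b₁ ∈ 𝔅.fil 1) (hb₂ : b₂ ∈ 𝔅.fil 0)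
    (k : Fin 2) :
    ((Matrix.of fun i j => (![φ₁, φ₂] : Fin 2 → (M →ₗ[P] 𝔅.B)) i (v j)).adjugate *ᵥ ![b₁, b₂]) k ∈ 𝔅.fil 1 := by
  have h10 : ∀ m, φ₂ m * b₁ ∈ 𝔅.fil 1 := fun m => by
    simpa using 𝔅.mul_mem_fil 0 1 _ _ (hfil₂ m) hb₁
  have h01 : ∀ m, φ₁ m * b₂ ∈ 𝔅.fil 1 := fun m => by
    simpa using 𝔅.mul_mem_fil 1 0 _ _ (hfil₁ m) hb₂
  rw [Matrix.adjugate_fin_two]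
  fin_cases k
  · simp only [Matrix.mulVec, dotProduct, Fin.sum_univ_two, Matrix.of_apply, Matrix.cons_val', Matrix.cons_val_zero,
      Matrix.cons_val_one, Matrix.empty_val', Matrix.cons_val_fin_one, Fin.zero_eta, Fin.isValue]
    exact add_mem (h10 _) (by rw [neg_mul]; exact neg_mem (h01 _))
  · simp only [Matrix.mulVec, dotProduct, Fin.sum_univ_two, Matrix.of_apply, Matrix.cons_val', Matrix.cons_val_zero,
      Matrix.cons_val_one, Matrix.empty_val', Matrix.cons_val_fin_one, Fin.mk_one, Fin.isValue]
    exact add_mem (by rw [neg_mul]; exact neg_mem (h10 _)) (h01 _)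

/-- **`Fil⁰`-coboundary from a Legendre-transversal pair of integrated periods.** `dim V = 2` with basis `v`;
`φ₁, φ₂` equivariant, `φ₁(V) ⊆ Fil¹`, `φ₂(V) ⊆ Fil⁰`, `φ₁ ≠ 0`, `φ₂(m) ∉ Fil¹` for some `m`; the period determinant
`Δ = φ₁(v₀)φ₂(v₁) − φ₁(v₁)φ₂(v₀)` divides `Fil¹` into `Fil⁰`; `b₁ ∈ Fil¹`, `b₂ ∈ Fil⁰` with `φᵢ(c σ) = σ bᵢ − bᵢ`. Then
`σ ↦ 1 ⊗ c(σ)` is a coboundary of `Fil⁰B ⊗ V` (`IsFilZeroCoboundary`). [cite: BlochKato1990, Ex. 3.10.1, (3.11.1), Lemma 3.8.1]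
[cite: Colmez1992PeriodesAbeliennes, §2] -/
theorem isFilZeroCoboundary_of_pair_of_legendre (v : Module.Basis (Fin 2) P M)
    {φ₁ φ₂ : M →ₗ[P] 𝔅.B} (h₁ : ∀ σ m, φ₁ (ρ σ m) = σ • φ₁ m) (h₂ : ∀ σ m, φ₂ (ρ σ m) = σ • φ₂ m)
    (hfil₁ : ∀ m, φ₁ m ∈ 𝔅.fil 1) (hfil₂ : ∀ m, φ₂ m ∈ 𝔅.fil 0) (hne : φ₁ ≠ 0) (hnot : ∃ m, φ₂ m ∉ 𝔅.fil 1)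
    (hdet : ∀ y ∈ 𝔅.fil 1, ∃ z ∈ 𝔅.fil 0, y = z * (φ₁ (v 0) * φ₂ (v 1) - φ₁ (v 1) * φ₂ (v 0)))
    (c : Γ → M) {b₁ b₂ : 𝔅.B} (hb₁ : b₁ ∈ 𝔅.fil 1) (hb₂ : b₂ ∈ 𝔅.fil 0)
    (hc₁ : ∀ σ, φ₁ (c σ) = σ • b₁ - b₁) (hc₂ : ∀ σ, φ₂ (c σ) = σ • b₂ - b₂) :
    𝔅.IsFilZeroCoboundary ρ fun σ => ((1 : 𝔅.B) ⊗ₜ[P] c σ : 𝔅.B ⊗[P] M) := by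
  classical
  let Φ : Fin 2 → (M →ₗ[P] 𝔅.B) := ![φ₁, φ₂]
  have hΦ : ∀ i σ m, Φ i (ρ σ m) = σ • Φ i m := fun k σ m => by fin_cases k <;> simp [Φ, h₁ σ m, h₂ σ m]
  have hli : LinearIndependent E Φ := 𝔅.linearIndependent_pair_of_fil hfil₁ hne hnot
  set H : Matrix (Fin 2) (Fin 2) 𝔅.B := Matrix.of fun i j => Φ i (v j) with hH
  let b : Fin 2 → 𝔅.B := ![b₁, b₂]
  have hc : ∀ i σ, Φ i (c σ) = σ • b i - b i := fun k σ => by fin_cases k <;> simp [Φ, b, hc₁ σ, hc₂ σ]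
  obtain ⟨hunit, -⟩ := 𝔅.isUnit_det_and_periodMatrix_of_equivariant ρ v hΦ hli
  -- `det H = Δ`
  have hdetH : H.det = φ₁ (v 0) * φ₂ (v 1) - φ₁ (v 1) * φ₂ (v 0) := by
    rw [Matrix.det_fin_two]
    simp only [hH, Matrix.of_apply, Φ, Matrix.cons_val_zero, Matrix.cons_val_one, Matrix.cons_val_fin_one]
  -- the entries of `adj(H) b` are in `Fil¹`, hence `= z_k Δ` with `z_k ∈ Fil⁰`
  have hadj : ∀ k, (H.adjugate *ᵥ b) k ∈ 𝔅.fil 1 := fun k => 𝔅.adjugate_mulVec_mem_fil_one v hfil₁ hfil₂ hb₁ hb₂ k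
  choose z hz hz' using fun k => hdet _ (hadj k)
  -- `H⁻¹ b = z`
  have hu : (↑hunit.unit⁻¹ : 𝔅.B) * H.det = 1 := hunit.val_inv_mul
  have hinv : H⁻¹ *ᵥ b = z := by
    funext k
    rw [Matrix.nonsing_inv_apply H hunit, Matrix.smul_mulVec, Pi.smul_apply, hz' k, ← hdetH, smul_eq_mul,
      mul_left_comm, hu, mul_one]
  refine ⟨∑ i, (H⁻¹ *ᵥ b) i • Algebra.TensorProduct.basis 𝔅.B v i, ?_, fun σ => ?_⟩
  · rw [hinv]
    exact 𝔅.sum_smul_basis_mem_filTensor v hz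
  · exact 𝔅.tensorRep_sub_eq_of_equivariant_basis ρ v hΦ hli c b hc σ

end PeriodHoms

end Literature.NumberTheory.GaloisRepresentations.PeriodRingData

/-! ## §2 Tate modules: the (S5a)-shaped conclusion from two integrated, Legendre-transversal periods -/

namespace Literature.NumberTheory.PAdicHodge

open Literature Literature.NumberTheory.GaloisRepresentations Literature.NumberTheory.EllipticCurves WeierstrassCurve
open Literature.NumberTheory.GaloisRepresentations.IsNonarchimedeanLocalField Field ValuativeRel

section Generic

variable {F : Type} [Field F] {p : ℕ} [Fact p.Prime] [Algebra ℚ_[p] F]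
  (𝔅 : PeriodRingData.{0, 0, 0, 0} (absoluteGaloisGroup F) ℚ_[p] F)
  {A : Type} [AddCommGroup A] (ρ : GaloisRep F ℚ_[p] (RationalTateModule A p))
  (act : absoluteGaloisGroup F → TateModule A p → TateModule A p)

/-- **`Fil⁰`-coboundary in `B ⊗ V_pA` from two integrated, Legendre-transversal periods on the lattice `T_pA`.** `ρ` on `V_pA`
induced by `act`, with a `ℚ_p`-basis `v` of `V_pA`; `φ₁ φ₂ : T_pA →+ B` additive, `ℤ_p`-homogeneous, equivariant with
`φ₁ ⊆ Fil¹`, `φ₂ ⊆ Fil⁰`, `φ₁ ≠ 0`, `φ₂(a) ∉ Fil¹` for some `a`; their `ℚ_p`-linear extensions `Φ₁, Φ₂` (any, agreeing with `φᵢ`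
on `T_pA`) have determinant `Δ = Φ₁(v₀)Φ₂(v₁) − Φ₁(v₁)Φ₂(v₀)` dividing `Fil¹` into `Fil⁰`; `η : Γ_F → T_pA` with
`φ₁(η σ) = σ b₁ − b₁`, `b₁ ∈ Fil¹`, `φ₂(η σ) = σ b₂ − b₂`, `b₂ ∈ Fil⁰`. Then `σ ↦ 1 ⊗ η(σ)` is a `Fil⁰`-coboundary.
[cite: BlochKato1990, Ex. 3.10.1, (3.11.1), Lemma 3.8.1] [cite: Colmez1992PeriodesAbeliennes, §2] -/
theorem isFilZeroCoboundary_rationalTateModule_of_periodHoms_of_legendre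
    (hρ : ∀ (σ : absoluteGaloisGroup F) (c : ℚ_[p]) (a : TateModule A p),
      ρ σ ((c ⊗ₜ[ℤ_[p]] a : ℚ_[p] ⊗[ℤ_[p]] TateModule A p) : RationalTateModule A p) =
        ((c ⊗ₜ[ℤ_[p]] act σ a : ℚ_[p] ⊗[ℤ_[p]] TateModule A p) : RationalTateModule A p))
    (v : Module.Basis (Fin 2) ℚ_[p] (RationalTateModule A p))
    (φ₁ φ₂ : TateModule A p →+ 𝔅.B)
    (hφ₁ : ∀ (c : ℤ_[p]) (a : TateModule A p), φ₁ (c • a) = (c : ℚ_[p]) • φ₁ a)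
    (hφ₂ : ∀ (c : ℤ_[p]) (a : TateModule A p), φ₂ (c • a) = (c : ℚ_[p]) • φ₂ a)
    (hσ₁ : ∀ (σ : absoluteGaloisGroup F) (a : TateModule A p), φ₁ (act σ a) = σ • φ₁ a)
    (hσ₂ : ∀ (σ : absoluteGaloisGroup F) (a : TateModule A p), φ₂ (act σ a) = σ • φ₂ a)
    (hfil₁ : ∀ a, φ₁ a ∈ 𝔅.fil 1) (hfil₂ : ∀ a, φ₂ a ∈ 𝔅.fil 0) (hne : ∃ a, φ₁ a ≠ 0) (hnot : ∃ a, φ₂ a ∉ 𝔅.fil 1)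
    (hdet : ∀ (Φ₁ Φ₂ : RationalTateModule A p →ₗ[ℚ_[p]] 𝔅.B), (∀ a, Φ₁ (TateModule.toRational p a) = φ₁ a) →
      (∀ a, Φ₂ (TateModule.toRational p a) = φ₂ a) →
      ∀ y ∈ 𝔅.fil 1, ∃ z ∈ 𝔅.fil 0, y = z * (Φ₁ (v 0) * Φ₂ (v 1) - Φ₁ (v 1) * Φ₂ (v 0)))
    (η : absoluteGaloisGroup F → TateModule A p) {b₁ b₂ : 𝔅.B} (hb₁ : b₁ ∈ 𝔅.fil 1) (hb₂ : b₂ ∈ 𝔅.fil 0)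
    (hη₁ : ∀ σ, φ₁ (η σ) = σ • b₁ - b₁) (hη₂ : ∀ σ, φ₂ (η σ) = σ • b₂ - b₂) :
    𝔅.IsFilZeroCoboundary ρ fun σ =>
      ((1 : 𝔅.B) ⊗ₜ[ℚ_[p]] TateModule.toRational p (η σ) : 𝔅.B ⊗[ℚ_[p]] RationalTateModule A p) := by
  obtain ⟨Φ₁, hΦ₁, hΦ₁σ⟩ := exists_equivariant_extend_rationalTateModule 𝔅 ρ act hρ φ₁ hφ₁ hσ₁
  obtain ⟨Φ₂, hΦ₂, hΦ₂σ⟩ := exists_equivariant_extend_rationalTateModule 𝔅 ρ act hρ φ₂ hφ₂ hσ₂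
  obtain ⟨a₁, ha₁⟩ := hne
  obtain ⟨a₂, ha₂⟩ := hnot
  refine 𝔅.isFilZeroCoboundary_of_pair_of_legendre ρ v hΦ₁σ hΦ₂σ
    (apply_mem_of_forall_toRational_mem 𝔅 Φ₁ (𝔅.fil 1) fun a => by rw [hΦ₁]; exact hfil₁ a)
    (apply_mem_of_forall_toRational_mem 𝔅 Φ₂ (𝔅.fil 0) fun a => by rw [hΦ₂]; exact hfil₂ a)
    (fun h0 => ha₁ ?_) ⟨TateModule.toRational p a₂, by rwa [hΦ₂]⟩ (hdet Φ₁ Φ₂ hΦ₁ hΦ₂)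
    (fun σ => TateModule.toRational p (η σ)) hb₁ hb₂ (fun σ => by rw [hΦ₁, hη₁]) (fun σ => by rw [hΦ₂, hη₂])
  rw [← hΦ₁ a₁, h0, LinearMap.zero_apply]

end Generic

section Elliptic

variable {F : Type} [Field F] [ValuativeRel F] [TopologicalSpace F] [IsNonarchimedeanLocalField F] [CharZero F]
  {p : ℕ} [Fact p.Prime] [Fact (¬ IsUnit (p : integerC F))] [IsAdicComplete (Ideal.span {(p : integerC F)}) (integerC F)]
  (hp : valuation F p < 1) [Algebra ℚ_[p] F]

/-- **(S5a)-shaped conclusion for a `T_pW`-valued map with integrated, Legendre-transversal periods** (`W` over a SUBFIELD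
`K₀ ⊆ F`; vocabulary of the cite-only `expStarCoord_eq_zero_iff_kummer`): period maps `φ₁ φ₂ : T_pW →+ B_dR(F)` (intended
`∫ω ∈ Fil¹`, `∫η ∈ B_dR⁺`), their extensions Legendre-transversal on a `ℚ_p`-basis `v` of `V_pW`, and `η : Γ_F → T_pW` with
`φ₁(η σ) = σ b₁ − b₁` (`b₁ ∈ Fil¹`), `φ₂(η σ) = σ b₂ − b₂` (`b₂ ∈ B_dR⁺`) ⟹
`(bdRPeriodRingData hp).IsFilZeroCoboundary (restrictedRationalTateRep W F p) (σ ↦ 1 ⊗ toRational (η σ))`.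
[cite: BlochKato1990, Ex. 3.10.1, (3.11.1), Lemma 3.8.1] [cite: Kato1993LNM1553, Ch. II Lemma 1.4.3] -/
theorem isFilZeroCoboundary_restrictedRationalTateRep_of_periodHoms_of_legendre {K₀ : Type} [Field K₀] [CharZero K₀]
    (W : WeierstrassCurve K₀) [W.IsElliptic] [Algebra K₀ F]
    (v : Module.Basis (Fin 2) ℚ_[p] (W.rationalTateModule p))
    (φ₁ φ₂ : W.tateModule p →+ (bdRPeriodRingData (F := F) (p := p) hp).B)
    (hφ₁ : ∀ (c : ℤ_[p]) (a : W.tateModule p), φ₁ (c • a) = (c : ℚ_[p]) • φ₁ a)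
    (hφ₂ : ∀ (c : ℤ_[p]) (a : W.tateModule p), φ₂ (c • a) = (c : ℚ_[p]) • φ₂ a)
    (hσ₁ : ∀ (σ : absoluteGaloisGroup F) (a : W.tateModule p), φ₁ (absGaloisRestrict K₀ F σ • a) = σ • φ₁ a)
    (hσ₂ : ∀ (σ : absoluteGaloisGroup F) (a : W.tateModule p), φ₂ (absGaloisRestrict K₀ F σ • a) = σ • φ₂ a)
    (hfil₁ : ∀ a, φ₁ a ∈ (bdRPeriodRingData (F := F) (p := p) hp).fil 1)
    (hfil₂ : ∀ a, φ₂ a ∈ (bdRPeriodRingData (F := F) (p := p) hp).fil 0) (hne : ∃ a, φ₁ a ≠ 0)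
    (hnot : ∃ a, φ₂ a ∉ (bdRPeriodRingData (F := F) (p := p) hp).fil 1)
    (hdet : ∀ (Φ₁ Φ₂ : W.rationalTateModule p →ₗ[ℚ_[p]] (bdRPeriodRingData (F := F) (p := p) hp).B),
      (∀ a, Φ₁ (TateModule.toRational p a) = φ₁ a) → (∀ a, Φ₂ (TateModule.toRational p a) = φ₂ a) →
      ∀ y ∈ (bdRPeriodRingData (F := F) (p := p) hp).fil 1, ∃ z ∈ (bdRPeriodRingData (F := F) (p := p) hp).fil 0,
        y = z * (Φ₁ (v 0) * Φ₂ (v 1) - Φ₁ (v 1) * Φ₂ (v 0)))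
    (η : absoluteGaloisGroup F → W.tateModule p) {b₁ b₂ : (bdRPeriodRingData (F := F) (p := p) hp).B}
    (hb₁ : b₁ ∈ (bdRPeriodRingData (F := F) (p := p) hp).fil 1) (hb₂ : b₂ ∈ (bdRPeriodRingData (F := F) (p := p) hp).fil 0)
    (hη₁ : ∀ σ, φ₁ (η σ) = σ • b₁ - b₁) (hη₂ : ∀ σ, φ₂ (η σ) = σ • b₂ - b₂) :
    (bdRPeriodRingData (F := F) (p := p) hp).IsFilZeroCoboundary (restrictedRationalTateRep W F p) fun σ =>
      ((1 : (bdRPeriodRingData (F := F) (p := p) hp).B) ⊗ₜ[ℚ_[p]] TateModule.toRational p (η σ) :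
        (bdRPeriodRingData (F := F) (p := p) hp).B ⊗[ℚ_[p]] W.rationalTateModule p) :=
  isFilZeroCoboundary_rationalTateModule_of_periodHoms_of_legendre (bdRPeriodRingData (F := F) (p := p) hp)
    (restrictedRationalTateRep W F p) (fun σ a => absGaloisRestrict K₀ F σ • a) (fun _ _ _ => rfl) v φ₁ φ₂ hφ₁ hφ₂ hσ₁ hσ₂
    hfil₁ hfil₂ hne hnot hdet η hb₁ hb₂ hη₁ hη₂

end Elliptic

end Literature.NumberTheory.PAdicHodge

end
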